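import Summits.CriticalPhenomena.PercolationContinuityZ3.Theorems.PercNearOneGluingAdditiveGluingBhkOneAny
import HarnessLib

/-! # Crux `PercNearOneGluing.AdditiveGluing` (stmt-CriticalPhenomena-4576), line `starglue/tieline`
— stub `stub_diagAnyTwo_c7` (BHK Thm. 1.3, two relays `s, t` avoiding the third relay `x`)

Helper file for the crux skeleton of the line `starglue/tieline` (lead
prover-line-stmt-CriticalPhenomena-4576-c7-0): proves exactly the registered stub signature
`stub_diagAnyTwo_c7`; lands with `--supports stmt-CriticalPhenomena-4576`.

## Content

Finite weighted graph on `Fin n` (`μ = prodBernoulli w` on `BondConfig (Fin n)`, events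
`{x ↔ y} = openConn x y`), three relays `s, t, x` with `s ≠ x`, `t ≠ x`, points `o, b`, and the
decreasing separation event `D' := {s ↮ x} ∩ {t ↮ x}`.  Then

`μ(D' ∩ ({s ↔ o} ∪ {t ↔ o})) · μ(D' ∩ ({s ↔ b} ∪ {t ↔ b}))
  ≤ μ(D') · μ(D' ∩ (({s ↔ o} ∪ {t ↔ o}) ∩ ({s ↔ b} ∪ {t ↔ b})))`,

i.e. given `D'` the increasing events `{o ∈ C_{{s,t}}}` and `{b ∈ C_{{s,t}}}` of the cluster of the
vertex set `{s, t}` are positively correlated.  This is the literal specialisation of the landed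
set lemma `stub_bhkOneAny_c7` (file `…AdditiveGluingBhkOneAny`, van den Berg–Häggström–Kahn (2006)
Thm. 1.3 for the cluster of a vertex set `S` given `{S ↮ X}`) to `S := {s, t}`,
`X := ({x} : Set (Fin n))` (admissible since `s ≠ x`, `t ≠ x`; `s = t` is allowed), after the set
identities `{ω | ∀ s' ∈ {s,t}, ∀ x' ∈ {x}, s' ↮ x'} = {s ↮ x} ∩ {t ↮ x}` and
`⋃_{s' ∈ {s,t}} {s' ↔ v} = {s ↔ v} ∪ {t ↔ v}` (`v = o, b`).
-/

namespace Summit.CriticalPhenomena.PercolationContinuityZ3.Theorems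

open MeasureTheory Set Literature.Probability.LatticeModels Literature.Probability.Percolation

noncomputable section
open Classical

/-- **BHK 2006 Thm. 1.3, two relays avoiding one:** for `s ≠ x`, `t ≠ x` and
`D' = {s ↮ x} ∩ {t ↮ x}`,
`μ(D' ∩ ({s ↔ o} ∪ {t ↔ o})) μ(D' ∩ ({s ↔ b} ∪ {t ↔ b}))
  ≤ μ(D') μ(D' ∩ (({s ↔ o} ∪ {t ↔ o}) ∩ ({s ↔ b} ∪ {t ↔ b})))`
— the specialisation `S = {s, t}`, `X = {x}` of the landed `stub_bhkOneAny_c7` (the increasing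
events `{o ∈ C_S}`, `{b ∈ C_S}` are positively correlated given `{S ↮ X}`).
[cite: VandenbergHaggstromKahn2005, Thm. 1.3 (p. 6)] -/
theorem stub_diagAnyTwo_c7 : ∀ (n : ℕ) (w : Sym2 (Fin n) → unitInterval) (s t x o b : Fin n), s ≠ x → t ≠ x → (prodBernoulli w).real ((openConn s x)ᶜ ∩ (openConn t x)ᶜ ∩ (openConn s o ∪ openConn t o)) * (prodBernoulli w).real ((openConn s x)ᶜ ∩ (openConn t x)ᶜ ∩ (openConn s b ∪ openConn t b)) ≤ (prodBernoulli w).real ((openConn s x)ᶜ ∩ (openConn t x)ᶜ) * (prodBernoulli w).real ((openConn s x)ᶜ ∩ (openConn t x)ᶜ ∩ ((openConn s o ∪ openConn t o) ∩ (openConn s b ∪ openConn t b))) := by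
  intro n w s t x o b hsx htx
  -- adapted from `stub_crossAnyTwoOne_c7` (…CrossAnyTwoOne): same `S = {s, t}` rewriting idiom
  have hSX : ∀ s' ∈ ({s, t} : Finset (Fin n)), s' ∉ ({x} : Set (Fin n)) := by
    intro s' hs'
    simp only [Finset.mem_insert, Finset.mem_singleton] at hs'
    rcases hs' with rfl | rfl
    · simpa using hsx
    · simpa using htx
  have hD : {ω : BondConfig (Fin n) | ∀ s' ∈ ({s, t} : Finset (Fin n)), ∀ x' ∈ ({x} : Set (Fin n)),
      ¬ (openGraph ω).Reachable s' x'} = (openConn s x)ᶜ ∩ (openConn t x)ᶜ := by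
    ext ω
    simp only [Finset.mem_insert, Finset.mem_singleton, forall_eq_or_imp, forall_eq,
      Set.mem_singleton_iff, mem_setOf_eq, mem_inter_iff, mem_compl_iff, openConn]
  have hSo : (⋃ s' ∈ ({s, t} : Finset (Fin n)), (openConn s' o : Set (BondConfig (Fin n)))) =
      openConn s o ∪ openConn t o := by
    rw [Finset.set_biUnion_insert, Finset.set_biUnion_singleton]
  have hSb : (⋃ s' ∈ ({s, t} : Finset (Fin n)), (openConn s' b : Set (BondConfig (Fin n)))) =
      openConn s b ∪ openConn t b := by
    rw [Finset.set_biUnion_insert, Finset.set_biUnion_singleton]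
  have key := stub_bhkOneAny_c7 n w {s, t} ({x} : Set (Fin n)) o b hSX
  rw [hD, hSo, hSb] at key
  exact key

end

end Summit.CriticalPhenomena.PercolationContinuityZ3.Theorems
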